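import Literature.IUT.LogThetaLattice.GlobalPacketsLGPRealified

/-!
# [IUTchIII] Proposition 3.4 (i): the natural isomorphism `Ψ_{log(^α𝓕_v)} ⥲ Ψ_{log(^{A,α}𝓕_v)}`

abc-iut cell, layer L6, SUB-DAG row W6-S13 (`plan/L6/SUBDAG-IUTchIII-Prop-34.md`, sub-node
Prop-34.i.r7/r8), seat abc-iut-w5-d180. S. Mochizuki, *Inter-universal Teichmüller theory III*,
kurims manuscript (May 2020), Proposition 3.4 (i), p. 102 l. 15–19: "when `v ∈ 𝕍^non`, the first
displayed monoid, together with its `^αΠ_v`-action, determine a Frobenioid equipped with a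
**natural isomorphism to** `log(^α𝓕_v)`; when `v ∈ 𝕍^arc`, the first displayed monoid … determine
a collection of data equipped with a natural isomorphism to `log(^α𝓕_v)`".

The typer's file (abc-iut-L6-t4, `GlobalPacketsLGP.lean` p403901) records these two clauses as
docstring text only (the Frobenioid / Aut-holomorphic-orbispace vocabulary is owed at the
L1/L4 merge). What the clauses rest on at the level of MONOIDS is kernel-checkable now and is
proved here: "forming the image via the natural homomorphism `log(^α𝓕_v) → log(^{A,α}𝓕_v)`"
(Proposition 3.1 (ii), an INJECTIVE ring homomorphism — `toPacketAt_injective`, p403825) maps the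
monoid `Ψ_{log(^α𝓕_v)}` ISOMORPHICALLY onto the single packet monoid `Ψ_{log(^{A,α}𝓕_v)}`
(`singlePacketMonoid`, t4) — `singlePacketMonoidEquiv` — and likewise the submonoid of units
onto `Ψ^×_{log(^{A,α}𝓕_v)}` (`singlePacketUnitsEquiv`); the isomorphism is natural in the sense
that on underlying elements it IS `ι` (`coe_singlePacketMonoidEquiv`), hence commutes with every
endomorphism of `log(^{A,α}𝓕_v)` extending one of `log(^α𝓕_v)` along `ι`
(`singlePacketMonoidEquiv_equivariant`: the `^αΠ_v`-equivariance clause at the level the tree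
models group actions). At the REAL packet of Proposition 3.1 (ii) one takes `ι = toPacketAt 𝕜 L α v`
and `hι = toPacketAt_injective 𝕜 L α v` (t4 `TensorPackets.lean` p403825); NOTE for the merge seat:
applying t4's `singlePacketMonoid` (binder `[CommRing Pv]`) to `toPacketAt` (codomain elaborated
with `Algebra.TensorProduct.instSemiring`) makes the unifier close the instance diamond
`instCommRing.toCommSemiring.toSemiring = instSemiring` on the packet type, which exceeds the default
heartbeat budget (observed 2026-08-26, farm) — pass `(Pv := PacketAt 𝕜 L α v)` AND restate `ι`
through `AlgHom` over the `CommRing`-derived instances, or generalise t4's binders to `[Semiring Pv]`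
at its next touch. Proof-side companion: no statement of p403901 / p403825 / the L6-d6
bridge `GlobalPacketsLGPRealified` is edited or restated. [claim: Mochizuki2012, status: disputed]
(D-0012 claim key; nothing here takes a side on [IUTchIII] Cor. 3.12; typed ≠ proved for the
Frobenioid-level clause, which stays owed at the merge.)
-/

namespace Literature.IUT.LogThetaLattice

universe u

section Abstract

variable {𝕜 : Type u} [Field 𝕜] {Lv : Type u} [CommRing Lv] [Algebra 𝕜 Lv]
variable {Pv : Type u} [CommRing Pv] [Algebra 𝕜 Pv]

/-- `Ψ ↠ ι(Ψ)` is injective as soon as `ι` is ([IUTchIII] Prop. 3.1 (ii): the natural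
homomorphism is injective). [claim: Mochizuki2012, status: disputed] -/
theorem toSinglePacketMonoid_injective (ι : Lv →ₐ[𝕜] Pv) (hι : Function.Injective ι)
    (Ψ : Submonoid Lv) : Function.Injective (toSinglePacketMonoid ι Ψ) := by
  intro x y h
  apply Subtype.ext
  apply hι
  simpa using congrArg (fun z : ↥(singlePacketMonoid ι Ψ) => (z : Pv)) h

/-- `Ψ ↠ ι(Ψ)` is bijective for injective `ι`. [claim: Mochizuki2012, status: disputed] -/
theorem toSinglePacketMonoid_bijective (ι : Lv →ₐ[𝕜] Pv) (hι : Function.Injective ι)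
    (Ψ : Submonoid Lv) : Function.Bijective (toSinglePacketMonoid ι Ψ) :=
  ⟨toSinglePacketMonoid_injective ι hι Ψ, toSinglePacketMonoid_surjective ι Ψ⟩

/-- **IUTchIII:Prop3.4(i)** (p. 102 l. 15–19), monoid level of "equipped with a natural
isomorphism to `log(^α𝓕_v)`": for injective `ι : log(^α𝓕_v) → log(^{A,α}𝓕_v)` the monoid
`Ψ_{log(^α𝓕_v)}` is isomorphic to the single packet monoid `Ψ_{log(^{A,α}𝓕_v)} = ι(Ψ)` via `ι`
itself. [claim: Mochizuki2012, status: disputed] -/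
noncomputable def singlePacketMonoidEquiv (ι : Lv →ₐ[𝕜] Pv) (hι : Function.Injective ι)
    (Ψ : Submonoid Lv) : ↥Ψ ≃* ↥(singlePacketMonoid ι Ψ) :=
  MulEquiv.ofBijective (toSinglePacketMonoid ι Ψ) (toSinglePacketMonoid_bijective ι hι Ψ)

/-- On underlying elements the natural isomorphism IS `ι`. [claim: Mochizuki2012, status: disputed] -/
@[simp] theorem coe_singlePacketMonoidEquiv (ι : Lv →ₐ[𝕜] Pv) (hι : Function.Injective ι)
    (Ψ : Submonoid Lv) (x : Ψ) :
    ((singlePacketMonoidEquiv ι hι Ψ x : ↥(singlePacketMonoid ι Ψ)) : Pv) = ι x := rfl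

/-- The inverse of the natural isomorphism recovers the preimage: `ι (e.symm y) = y`.
[claim: Mochizuki2012, status: disputed] -/
@[simp] theorem coe_singlePacketMonoidEquiv_symm (ι : Lv →ₐ[𝕜] Pv) (hι : Function.Injective ι)
    (Ψ : Submonoid Lv) (y : ↥(singlePacketMonoid ι Ψ)) :
    ι ((singlePacketMonoidEquiv ι hι Ψ).symm y : Ψ) = (y : Pv) := by
  have h := coe_singlePacketMonoidEquiv ι hι Ψ ((singlePacketMonoidEquiv ι hι Ψ).symm y)
  rw [MulEquiv.apply_symm_apply] at h
  exact h.symm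

/-- NATURALITY / equivariance (p. 102 "together with its `^αΠ_v`-action"): if an endomorphism
`σ` of `log(^α𝓕_v)` preserving `Ψ` extends along `ι` to an endomorphism `τ` of `log(^{A,α}𝓕_v)`
(`τ ∘ ι = ι ∘ σ`), then the natural isomorphism intertwines `σ` on `Ψ` with `τ` on `ι(Ψ)`.
[claim: Mochizuki2012, status: disputed] -/
theorem singlePacketMonoidEquiv_equivariant (ι : Lv →ₐ[𝕜] Pv) (hι : Function.Injective ι)
    (Ψ : Submonoid Lv) (σ : Lv →* Lv) (τ : Pv →* Pv) (hστ : ∀ x, τ (ι x) = ι (σ x))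
    (hσ : ∀ x ∈ Ψ, σ x ∈ Ψ) (x : Ψ) :
    ((singlePacketMonoidEquiv ι hι Ψ ⟨σ x, hσ x x.2⟩ : ↥(singlePacketMonoid ι Ψ)) : Pv) =
      τ ((singlePacketMonoidEquiv ι hι Ψ x : ↥(singlePacketMonoid ι Ψ)) : Pv) := by
  simp [hστ]

/-- The image monoid is stable under any such extension `τ` (so `τ` restricts to an endomorphism
of `Ψ_{log(^{A,α}𝓕_v)}`, the "`G_v(^αΠ_v)`-action" on the single packet monoid).
[claim: Mochizuki2012, status: disputed] -/
theorem singlePacketMonoid_map_stable (ι : Lv →ₐ[𝕜] Pv) (Ψ : Submonoid Lv) (σ : Lv →* Lv)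
    (τ : Pv →* Pv) (hστ : ∀ x, τ (ι x) = ι (σ x)) (hσ : ∀ x ∈ Ψ, σ x ∈ Ψ) {y : Pv}
    (hy : y ∈ singlePacketMonoid ι Ψ) : τ y ∈ singlePacketMonoid ι Ψ := by
  obtain ⟨x, hx, rfl⟩ := hy
  exact ⟨σ x, hσ x hx, by simpa using (hστ x).symm⟩

/-- The homomorphism `Ψ^×_{log(^α𝓕_v)} ↠ Ψ^×_{log(^{A,α}𝓕_v)}` (restriction of `ι` to the units
of `Ψ`, onto `singlePacketUnits ι Ψ`). [claim: Mochizuki2012, status: disputed] -/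
def toSinglePacketUnits (ι : Lv →ₐ[𝕜] Pv) (Ψ : Submonoid Lv) :
    ↥(IsUnit.submonoid ↥Ψ) →* ↥(singlePacketUnits ι Ψ) :=
  ((ι : Lv →* Pv).comp Ψ.subtype).submonoidMap (IsUnit.submonoid ↥Ψ)

/-- On underlying elements `toSinglePacketUnits` is `ι`. [claim: Mochizuki2012, status: disputed] -/
@[simp] theorem coe_toSinglePacketUnits (ι : Lv →ₐ[𝕜] Pv) (Ψ : Submonoid Lv)
    (x : ↥(IsUnit.submonoid ↥Ψ)) :
    ((toSinglePacketUnits ι Ψ x : ↥(singlePacketUnits ι Ψ)) : Pv) = ι (x : Ψ) := rfl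

/-- `Ψ^× ↠ ι(Ψ^×)` is surjective. [claim: Mochizuki2012, status: disputed] -/
theorem toSinglePacketUnits_surjective (ι : Lv →ₐ[𝕜] Pv) (Ψ : Submonoid Lv) :
    Function.Surjective (toSinglePacketUnits ι Ψ) :=
  ((ι : Lv →* Pv).comp Ψ.subtype).submonoidMap_surjective _

/-- `Ψ^× ↠ ι(Ψ^×)` is injective for injective `ι`. [claim: Mochizuki2012, status: disputed] -/
theorem toSinglePacketUnits_injective (ι : Lv →ₐ[𝕜] Pv) (hι : Function.Injective ι)
    (Ψ : Submonoid Lv) : Function.Injective (toSinglePacketUnits ι Ψ) := by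
  intro x y h
  apply Subtype.ext
  apply Subtype.ext
  apply hι
  simpa using congrArg (fun z : ↥(singlePacketUnits ι Ψ) => (z : Pv)) h

/-- **IUTchIII:Prop3.4(i)** (p. 102 l. 2–8 "together with its submonoid of units … determines
… `Ψ^×_{log(^{A,α}𝓕_v)}`"), units level of the natural isomorphism: for injective `ι` the
restriction of `ι` is an isomorphism from the units of `Ψ` onto `Ψ^×_{log(^{A,α}𝓕_v)}`
(`singlePacketUnits`, t4). [claim: Mochizuki2012, status: disputed] -/
noncomputable def singlePacketUnitsEquiv (ι : Lv →ₐ[𝕜] Pv) (hι : Function.Injective ι)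
    (Ψ : Submonoid Lv) : ↥(IsUnit.submonoid ↥Ψ) ≃* ↥(singlePacketUnits ι Ψ) :=
  MulEquiv.ofBijective (toSinglePacketUnits ι Ψ)
    ⟨toSinglePacketUnits_injective ι hι Ψ, toSinglePacketUnits_surjective ι Ψ⟩

/-- On underlying elements the units isomorphism IS `ι`. [claim: Mochizuki2012, status: disputed] -/
@[simp] theorem coe_singlePacketUnitsEquiv (ι : Lv →ₐ[𝕜] Pv) (hι : Function.Injective ι)
    (Ψ : Submonoid Lv) (x : ↥(IsUnit.submonoid ↥Ψ)) :
    ((singlePacketUnitsEquiv ι hι Ψ x : ↥(singlePacketUnits ι Ψ)) : Pv) = ι (x : Ψ) := rfl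

end Abstract


end Literature.IUT.LogThetaLattice
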